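import Summits.NavierStokesRegularity.FluidComputer.AngularGalerkinLadderLaplacian
import Summits.NavierStokesRegularity.FluidComputer.AngularGalerkinLadderRadialCutoff
import Literature.Analysis.FluidPDE.SpaceTimeMixedPartials

/-!
# The angular Galerkin ladder: the structure lemma of `NS_L`, projection-free — time derivatives
# stay in the band, the nonlinearity splits as (band part) + (defect), and the splitting is unique
# (theorems only)

Cell `ns-blowup`, seat `ns-blowup-lean` (g11). LABEL: KERNEL typing hygiene for the vocabulary of
`FluidComputer/AngularGalerkinLadder.lean` (route `Theses/AngularGalerkinLadder.lean`, tribunal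
round 1 PASSED). WHAT THIS IS NOT: not Navier–Stokes evidence — bookkeeping identities for GIVEN
rung solutions; nothing is asserted about the existence, regularity or blow-up of any rung
solution, no profile is constructed, no crux is touched.

## Content

§1 **Band ∩ co-band = 0.** A field that is band-limited (hence smooth) AND co-band-limited of the
same degree vanishes identically (`IsBandLimited.eq_zero_of_isCobandLimited`): test the
orthogonality against the compactly supported band-limited field `χ(‖·‖²) u` (`χ` a bump,
`IsBandLimited.radial_smul`) to get `∫ χ(‖x‖²)‖u x‖² = 0`. Hence a field has AT MOST ONE splitting
`g = b + e` with `b` band-limited and `e` continuous co-band-limited (`bandSplit_unique`).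

§2 **Time derivatives stay in the band.** For a jointly smooth family `w : ℝ → ℝ³ → ℝ³` on a time
set `S` of unique differentiability the one-sided time derivative `∂ₜ = timeDerivWithin S`
commutes with the rotation generators, the Casimir and the band defects
(`timeDerivWithin_angGen/casimir/bandDefect`; the exchange of `∂ₜ` with spatial derivatives is
the tree's `IsSmoothSpaceTimeOn.timeDerivWithin_fderiv_slice_apply_of_uniqueDiffOn`), so a
family of band-limited slices has band-limited time derivatives
(`isBandLimited_timeDerivWithin`).

§3 **The structure lemma of `NS_L`, projection-free.** On a rung-`L` solution `(u, p, d)` on a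
time set `S` of unique differentiability (`IsRungSolutionOn S ν L u p d`), for every `t ∈ S`:
`∂ₜu(t)` and `νΔu(t)` are band-limited (`…isBandLimited_timeDerivWithin`, file
`AngularGalerkinLadderLaplacian`), hence by the momentum equation
**`(u·∇)u + ∇p − d` is band-limited** (`…isBandLimited_convect_add_gradient_sub_force`):
the nonlinearity-plus-pressure-gradient splits as `(u·∇)u + ∇p = b + d` with `b` band-limited of
degree `≤ L` and `d` the co-band-limited defect (`…exists_bandSplit_nonlinearity`), and this
splitting is UNIQUE (`…bandSplit_nonlinearity_unique`) — the typed form, without a projection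
operator, of «`d = (1 − Π_L)((u·∇)u + ∇p)`, `NS_L : ∂ₜu = νΔu − Π_L((u·∇)u + ∇p)`» from the module
docstring of `AngularGalerkinLadder.lean`. For rung PROFILES (`S = (−∞, 0)`) the same holds at
every `t < 0` (`IsRungProfile.…`).

References: [cite: BullardGellman1954] (vector spherical harmonics: the isotypic splitting);
[cite: MajdaBertozziCUP2002, §1.4, proof of Prop. 1.5] (exchange `(v_{x_k})_t = (v_t)_{x_k}` when
differentiating the Navier–Stokes system).
-/

noncomputable section

namespace Summit.NavierStokesRegularity.FluidComputer

open Set MeasureTheory Filter Topology Function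
open scoped ContDiff RealInnerProductSpace Laplacian
open Literature.Analysis.FluidPDE

namespace AngularLadder

/-! ## §1 Band ∩ co-band = 0; uniqueness of band splittings -/

variable {L : ℕ} {u g : EuclideanSpace ℝ (Fin 3) → EuclideanSpace ℝ (Fin 3)}

/-- **A field that is both band-limited and co-band-limited of the same degree vanishes**: the
isotypic components of degree `≤ L` and `> L` meet only in `0`. Proof: for a smooth bump `χ`
equal to `1` near `‖x₀‖²`, the field `χ(‖·‖²) u` is band-limited with compact support
(`IsBandLimited.radial_smul`), so `0 = ∫⟪u, χ(‖·‖²) u⟫ = ∫ χ(‖x‖²)‖u x‖²` with a continuous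
nonnegative integrand, forcing `u x₀ = 0`. [cite: BullardGellman1954] -/
theorem IsBandLimited.eq_zero_of_isCobandLimited (hu : IsBandLimited L u) (hc : IsCobandLimited L u) :
    u = 0 := by
  funext x₀
  -- a smooth compactly supported radial profile, `= 1` near `‖x₀‖²`, with values in `[0, 1]`
  let χ : ContDiffBump (‖x₀‖ ^ 2 : ℝ) := ⟨1, 2, one_pos, one_lt_two⟩
  have hχs : ContDiff ℝ ∞ (χ : ℝ → ℝ) := χ.contDiff
  have hχc : HasCompactSupport (χ : ℝ → ℝ) := χ.hasCompactSupport
  have h0 : ∫ x, ⟪u x, (χ : ℝ → ℝ) (‖x‖ ^ 2) • u x⟫ = 0 :=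
    hc _ (hu.radial_smul hχs) (hasCompactSupport_radial_smul hχc u)
  have hint : ∀ x, ⟪u x, (χ : ℝ → ℝ) (‖x‖ ^ 2) • u x⟫ = (χ : ℝ → ℝ) (‖x‖ ^ 2) * ‖u x‖ ^ 2 :=
    fun x => by rw [real_inner_smul_right, real_inner_self_eq_norm_sq]
  simp only [hint] at h0
  have huc : Continuous u := hu.1.continuous
  have hFc : Continuous fun x : EuclideanSpace ℝ (Fin 3) => (χ : ℝ → ℝ) (‖x‖ ^ 2) * ‖u x‖ ^ 2 :=
    (χ.continuous.comp (continuous_norm.pow 2)).mul (huc.norm.pow 2)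
  have hFnn : 0 ≤ fun x : EuclideanSpace ℝ (Fin 3) => (χ : ℝ → ℝ) (‖x‖ ^ 2) * ‖u x‖ ^ 2 :=
    fun x => mul_nonneg χ.nonneg (sq_nonneg _)
  have hψc : HasCompactSupport fun x : EuclideanSpace ℝ (Fin 3) => (χ : ℝ → ℝ) (‖x‖ ^ 2) • u x :=
    hasCompactSupport_radial_smul hχc u
  have hFs : HasCompactSupport fun x : EuclideanSpace ℝ (Fin 3) =>
      (χ : ℝ → ℝ) (‖x‖ ^ 2) * ‖u x‖ ^ 2 :=
    hψc.mono (Function.support_subset_iff'.2 fun x hx => by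
      have hx0 : (χ : ℝ → ℝ) (‖x‖ ^ 2) • u x = 0 := by
        simpa only [Function.mem_support, ne_eq, not_not] using hx
      rcases smul_eq_zero.1 hx0 with h1 | h1
      · rw [h1, zero_mul]
      · rw [h1, norm_zero, zero_pow two_ne_zero, mul_zero])
  have hFi : Integrable fun x : EuclideanSpace ℝ (Fin 3) => (χ : ℝ → ℝ) (‖x‖ ^ 2) * ‖u x‖ ^ 2 :=
    hFc.integrable_of_hasCompactSupport hFs
  have hae := (integral_eq_zero_iff_of_nonneg hFnn hFi).1 h0
  have heq : (fun x : EuclideanSpace ℝ (Fin 3) => (χ : ℝ → ℝ) (‖x‖ ^ 2) * ‖u x‖ ^ 2) = 0 :=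
    (hFc.ae_eq_iff_eq volume continuous_const).1 hae
  have hx₀ := congrFun heq x₀
  have hχ1 : (χ : ℝ → ℝ) (‖x₀‖ ^ 2) = 1 := χ.one_of_mem_closedBall (Metric.mem_closedBall_self χ.rIn_pos.le)
  simp only [hχ1, one_mul, Pi.zero_apply] at hx₀
  exact norm_eq_zero.1 (pow_eq_zero_iff two_ne_zero |>.1 hx₀)

/-- **Uniqueness of band splittings**: if `b + e = b' + e'` with `b, b'` band-limited and `e, e'`
CONTINUOUS co-band-limited fields of the same degree, then `b = b'` and `e = e'`. [folklore] -/
theorem bandSplit_unique {b b' e e' : EuclideanSpace ℝ (Fin 3) → EuclideanSpace ℝ (Fin 3)}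
    (hb : IsBandLimited L b) (hb' : IsBandLimited L b') (he : IsCobandLimited L e)
    (he' : IsCobandLimited L e') (hec : Continuous e) (hec' : Continuous e')
    (h : b + e = b' + e') : b = b' ∧ e = e' := by
  have hbe : b - b' = e' - e := sub_eq_sub_iff_add_eq_add.2 (h.trans (add_comm _ _))
  have hd : IsBandLimited L (b - b') := hb.sub hb'
  have hd' : IsCobandLimited L (b - b') := by
    rw [hbe, sub_eq_add_neg]
    exact he'.add he.neg hec' hec.neg
  have h0 : b - b' = 0 := hd.eq_zero_of_isCobandLimited hd'
  refine ⟨sub_eq_zero.1 h0, ?_⟩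
  have : e' - e = 0 := by rw [← hbe, h0]
  exact (sub_eq_zero.1 this).symm

/-! ## §2 Time derivatives of band-limited families -/

section TimeDeriv

variable {S : Set ℝ} {w : ℝ → EuclideanSpace ℝ (Fin 3) → EuclideanSpace ℝ (Fin 3)} {t : ℝ}

/-- The generators of a jointly smooth family form a jointly smooth family (on a time set of
unique differentiability). [folklore] -/
theorem isSmoothSpaceTimeOn_angGen (h : IsSmoothSpaceTimeOn S w) (hS : UniqueDiffOn ℝ S)
    (a : Fin 3) : IsSmoothSpaceTimeOn S fun s => angGen a (w s) := by
  have e : (fun s => angGen a (w s)) =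
      fun s x => crossCLM (axis a) (w s x) - fderiv ℝ (w s) x (crossCLM (axis a) x) :=
    funext fun s => angGen_eq a (w s)
  rw [e]
  have h1 : IsSmoothSpaceTimeOn S fun s x => crossCLM (axis a) (w s x) :=
    IsSmoothSpaceTimeOn.clm_apply (L := fun _ _ => crossCLM (axis a)) contDiffOn_const h
  have hK : IsSmoothSpaceTimeOn S fun (_ : ℝ) (x : EuclideanSpace ℝ (Fin 3)) => crossCLM (axis a) x :=
    ((crossCLM (axis a)).contDiff.comp contDiff_snd).contDiffOn
  exact h1.sub ((h.fderiv_slice hS).clm_apply hK)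

/-- **The time derivative commutes with the rotation generators**: for a jointly smooth family
`w` on a time set `S` of unique differentiability and `t ∈ S`,
`∂ₜ (J_a w)(t) = J_a (∂ₜ w (t))` (`∂ₜ = timeDerivWithin S`; the exchange of `∂ₜ` with the spatial
derivative is the tree's `IsSmoothSpaceTimeOn.timeDerivWithin_fderiv_slice_apply_of_uniqueDiffOn`).
[cite: MajdaBertozziCUP2002, §1.4, proof of Prop. 1.5] -/
theorem timeDerivWithin_angGen (h : IsSmoothSpaceTimeOn S w) (hS : UniqueDiffOn ℝ S) (ht : t ∈ S)
    (a : Fin 3) :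
    timeDerivWithin S (fun s => angGen a (w s)) t =
      angGen a (timeDerivWithin S w t) := by
  funext x
  have h1 := h.hasDerivWithinAt_timeDerivWithin hS ht x
  have h2 : HasDerivWithinAt (fun s => crossCLM (axis a) (w s x))
      (crossCLM (axis a) (timeDerivWithin S w t x)) S t :=
    (crossCLM (axis a)).hasFDerivAt.comp_hasDerivWithinAt t h1
  have hF : IsSmoothSpaceTimeOn S fun s y => fderiv ℝ (w s) y (crossCLM (axis a) x) :=
    (h.fderiv_slice hS).clm_apply (v := fun _ _ => crossCLM (axis a) x) contDiffOn_const
  have h3 := hF.hasDerivWithinAt_timeDerivWithin hS ht x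
  have h4 : HasDerivWithinAt (fun s => crossCLM (axis a) (w s x) - fderiv ℝ (w s) x (crossCLM (axis a) x))
      (crossCLM (axis a) (timeDerivWithin S w t x) -
        timeDerivWithin S (fun s y => fderiv ℝ (w s) y (crossCLM (axis a) x)) t x) S t :=
    h2.sub h3
  have e : (fun s => angGen a (w s) x) =
      fun s => crossCLM (axis a) (w s x) - fderiv ℝ (w s) x (crossCLM (axis a) x) :=
    funext fun s => by rw [angGen_eq]
  rw [timeDerivWithin_apply, e, h4.derivWithin (hS t ht),
    h.timeDerivWithin_fderiv_slice_apply_of_uniqueDiffOn hS ht x (crossCLM (axis a) x), angGen_eq]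

/-- The Casimir of a jointly smooth family is jointly smooth. [folklore] -/
theorem isSmoothSpaceTimeOn_casimir (h : IsSmoothSpaceTimeOn S w) (hS : UniqueDiffOn ℝ S) :
    IsSmoothSpaceTimeOn S fun s => casimir (w s) := by
  have hJJ : ∀ a : Fin 3, IsSmoothSpaceTimeOn S fun s => angGen a (angGen a (w s)) := fun a =>
    isSmoothSpaceTimeOn_angGen (isSmoothSpaceTimeOn_angGen h hS a) hS a
  have hsum : IsSmoothSpaceTimeOn S fun s x => ∑ a : Fin 3, angGen a (angGen a (w s)) x :=
    ContDiffOn.sum fun a _ => hJJ a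
  exact ContDiffOn.neg hsum

/-- **The time derivative commutes with the Casimir**: `∂ₜ (𝒞 w)(t) = 𝒞 (∂ₜ w (t))`, `t ∈ S`.
[folklore] -/
theorem timeDerivWithin_casimir (h : IsSmoothSpaceTimeOn S w) (hS : UniqueDiffOn ℝ S) (ht : t ∈ S) :
    timeDerivWithin S (fun s => casimir (w s)) t =
      casimir (timeDerivWithin S w t) := by
  funext x
  have hJ : ∀ a : Fin 3, IsSmoothSpaceTimeOn S fun s => angGen a (w s) := fun a =>
    isSmoothSpaceTimeOn_angGen h hS a
  have hJJ : ∀ a : Fin 3, IsSmoothSpaceTimeOn S fun s => angGen a (angGen a (w s)) := fun a =>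
    isSmoothSpaceTimeOn_angGen (hJ a) hS a
  have hD : ∀ a : Fin 3, HasDerivWithinAt (fun s => angGen a (angGen a (w s)) x)
      (angGen a (angGen a (timeDerivWithin S w t)) x) S t := fun a => by
    have h1 := (hJJ a).hasDerivWithinAt_timeDerivWithin hS ht x
    rwa [timeDerivWithin_angGen (hJ a) hS ht a, timeDerivWithin_angGen h hS ht a] at h1
  have hsum : HasDerivWithinAt (fun s => -∑ a : Fin 3, angGen a (angGen a (w s)) x)
      (-∑ a : Fin 3, angGen a (angGen a (timeDerivWithin S w t)) x) S t :=
    (HasDerivWithinAt.fun_sum fun a _ => hD a).neg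
  rw [timeDerivWithin_apply]
  exact hsum.derivWithin (hS t ht)

/-- Every band defect of a jointly smooth family is jointly smooth. [folklore] -/
theorem isSmoothSpaceTimeOn_bandDefect (h : IsSmoothSpaceTimeOn S w) (hS : UniqueDiffOn ℝ S)
    (L : ℕ) : IsSmoothSpaceTimeOn S fun s => bandDefect L (w s) := by
  induction L with
  | zero => exact isSmoothSpaceTimeOn_casimir h hS
  | succ L ih =>
      change IsSmoothSpaceTimeOn S fun s x => casimir (bandDefect L (w s)) x -
        (((L : ℝ) + 1) * ((L : ℝ) + 2)) • bandDefect L (w s) x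
      exact (isSmoothSpaceTimeOn_casimir ih hS).sub (ih.const_smul _)

/-- **The time derivative commutes with every band defect**:
`∂ₜ (∏_{j ≤ L}(𝒞 − j(j+1)) w)(t) = ∏_{j ≤ L}(𝒞 − j(j+1)) (∂ₜ w (t))`, `t ∈ S`. [folklore] -/
theorem timeDerivWithin_bandDefect (h : IsSmoothSpaceTimeOn S w) (hS : UniqueDiffOn ℝ S)
    (ht : t ∈ S) (L : ℕ) :
    timeDerivWithin S (fun s => bandDefect L (w s)) t =
      bandDefect L (timeDerivWithin S w t) := by
  induction L with
  | zero => exact timeDerivWithin_casimir h hS ht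
  | succ L ih =>
      have hB : IsSmoothSpaceTimeOn S fun s => bandDefect L (w s) := isSmoothSpaceTimeOn_bandDefect h hS L
      have hC : IsSmoothSpaceTimeOn S fun s => casimir (bandDefect L (w s)) :=
        isSmoothSpaceTimeOn_casimir hB hS
      funext x
      have h1 : HasDerivWithinAt (fun s => casimir (bandDefect L (w s)) x)
          (casimir (bandDefect L (timeDerivWithin S w t)) x) S t := by
        have h0 := hC.hasDerivWithinAt_timeDerivWithin hS ht x
        rwa [timeDerivWithin_casimir hB hS ht, ih] at h0
      have h2 : HasDerivWithinAt (fun s => bandDefect L (w s) x)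
          (bandDefect L (timeDerivWithin S w t) x) S t := by
        have h0 := hB.hasDerivWithinAt_timeDerivWithin hS ht x
        rwa [ih] at h0
      have h3 : HasDerivWithinAt (fun s => casimir (bandDefect L (w s)) x -
            (((L : ℝ) + 1) * ((L : ℝ) + 2)) • bandDefect L (w s) x)
          (casimir (bandDefect L (timeDerivWithin S w t)) x -
            (((L : ℝ) + 1) * ((L : ℝ) + 2)) • bandDefect L (timeDerivWithin S w t) x) S t :=
        h1.sub (h2.const_smul (((L : ℝ) + 1) * ((L : ℝ) + 2)))
      rw [timeDerivWithin_apply]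
      exact h3.derivWithin (hS t ht)

/-- The slices of the time derivative of a jointly smooth family are smooth. [folklore] -/
private theorem contDiff_timeDerivWithin_slice' (h : IsSmoothSpaceTimeOn S w) (hS : UniqueDiffOn ℝ S)
    (ht : t ∈ S) : ContDiff ℝ ∞ (timeDerivWithin S w t) :=
  (h.timeDerivWithin hS).contDiff_slice ht

/-- **Time derivatives of band-limited families are band-limited**: if `w` is jointly smooth on a
time set `S` of unique differentiability and every slice `w s`, `s ∈ S`, is band-limited of degree
`≤ L`, then so is `∂ₜ w (t)` for every `t ∈ S` (`∏(𝒞 − j(j+1)) ∂ₜw = ∂ₜ ∏(𝒞 − j(j+1)) w = ∂ₜ 0`).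
[cite: BullardGellman1954] -/
theorem isBandLimited_timeDerivWithin (h : IsSmoothSpaceTimeOn S w) (hS : UniqueDiffOn ℝ S)
    (hB : ∀ s ∈ S, IsBandLimited L (w s)) (ht : t ∈ S) :
    IsBandLimited L (timeDerivWithin S w t) := by
  refine ⟨contDiff_timeDerivWithin_slice' h hS ht, fun x => ?_⟩
  rw [← timeDerivWithin_bandDefect h hS ht L, timeDerivWithin_apply]
  have h0 : ∀ s ∈ S, bandDefect L (w s) x = (0 : EuclideanSpace ℝ (Fin 3)) := fun s hs => (hB s hs).2 x
  rw [derivWithin_congr h0 (h0 t ht)]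
  simp

end TimeDeriv

/-! ## §3 Rung solutions: the structure lemma, projection-free -/

section Rung

variable {S : Set ℝ} {ν : ℝ} {L : ℕ}
  {v : ℝ → EuclideanSpace ℝ (Fin 3) → EuclideanSpace ℝ (Fin 3)}
  {p : ℝ → EuclideanSpace ℝ (Fin 3) → ℝ}
  {d : ℝ → EuclideanSpace ℝ (Fin 3) → EuclideanSpace ℝ (Fin 3)} {t : ℝ}

/-- On a rung-`L` solution (time set of unique differentiability) every time derivative
`∂ₜu(t)`, `t ∈ S`, is band-limited of degree `≤ L`. [cite: BullardGellman1954] -/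
theorem IsRungSolutionOn.isBandLimited_timeDerivWithin (h : IsRungSolutionOn S ν L v p d)
    (hS : UniqueDiffOn ℝ S) (ht : t ∈ S) :
    IsBandLimited L (timeDerivWithin S v t) :=
  AngularLadder.isBandLimited_timeDerivWithin h.1.smooth_velocity hS h.2.1 ht

/-- **The structure lemma of `NS_L` (projection-free form)**: on a rung-`L` solution
`(u, p, d)` on a time set of unique differentiability, the field `(u·∇)u + ∇p − d` at time
`t ∈ S` is band-limited of degree `≤ L` — it equals `νΔu − ∂ₜu` by the momentum equation, and
both terms stay in the band. [cite: BullardGellman1954] -/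
theorem IsRungSolutionOn.isBandLimited_convect_add_gradient_sub_force
    (h : IsRungSolutionOn S ν L v p d) (hS : UniqueDiffOn ℝ S) (ht : t ∈ S) :
    IsBandLimited L fun x => convect (v t) (v t) x + gradient (p t) x - d t x := by
  have e : (fun x => convect (v t) (v t) x + gradient (p t) x - d t x) =
      (fun x => ν • Δ (v t) x) - timeDerivWithin S v t := by
    funext x
    have hm := h.1.momentum t ht x
    show _ = ν • Δ (v t) x - timeDerivWithin S v t x
    calc convect (v t) (v t) x + gradient (p t) x - d t x
        = (timeDerivWithin S v t x + convect (v t) (v t) x) -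
            timeDerivWithin S v t x + gradient (p t) x - d t x := by abel
      _ = (ν • Δ (v t) x - gradient (p t) x + d t x) -
            timeDerivWithin S v t x + gradient (p t) x - d t x := by rw [hm]
      _ = ν • Δ (v t) x - timeDerivWithin S v t x := by abel
  rw [e]
  exact (h.isBandLimited_viscous ht).sub (h.isBandLimited_timeDerivWithin hS ht)

/-- **Band splitting of the nonlinearity**: on a rung-`L` solution, at every `t ∈ S` the
nonlinearity plus pressure gradient splits as `(u·∇)u + ∇p = b + d(t)` with `b` band-limited of
degree `≤ L` and `d(t)` the co-band-limited Galerkin defect — the projection-free form of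
`d = (1 − Π_L)((u·∇)u + ∇p)`. [cite: BullardGellman1954] -/
theorem IsRungSolutionOn.exists_bandSplit_nonlinearity (h : IsRungSolutionOn S ν L v p d)
    (hS : UniqueDiffOn ℝ S) (ht : t ∈ S) :
    ∃ b : EuclideanSpace ℝ (Fin 3) → EuclideanSpace ℝ (Fin 3),
      IsBandLimited L b ∧ IsCobandLimited L (d t) ∧
        (fun x => convect (v t) (v t) x + gradient (p t) x) = b + d t :=
  ⟨fun x => convect (v t) (v t) x + gradient (p t) x - d t x,
    h.isBandLimited_convect_add_gradient_sub_force hS ht, h.2.2 t ht,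
    funext fun x => by simp⟩

/-- **The band splitting of the nonlinearity is unique**: on a rung-`L` solution, if
`(u·∇)u + ∇p = b + e` at time `t ∈ S` with `b` band-limited and `e` a continuous co-band-limited
field, then `e = d(t)` (and `b = (u·∇)u + ∇p − d(t)`): the defect is determined by the velocity
and the pressure. [cite: BullardGellman1954] -/
theorem IsRungSolutionOn.bandSplit_nonlinearity_unique (h : IsRungSolutionOn S ν L v p d)
    (hS : UniqueDiffOn ℝ S) (ht : t ∈ S) {b e : EuclideanSpace ℝ (Fin 3) → EuclideanSpace ℝ (Fin 3)}
    (hb : IsBandLimited L b) (he : IsCobandLimited L e) (hec : Continuous e)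
    (hsplit : (fun x => convect (v t) (v t) x + gradient (p t) x) = b + e) :
    e = d t ∧ b = fun x => convect (v t) (v t) x + gradient (p t) x - d t x := by
  have hdc : Continuous (d t) := h.1.continuous_force_slice hS ht
  have h2 : (fun x => convect (v t) (v t) x + gradient (p t) x - d t x) + d t = b + e := by
    rw [← hsplit]; funext x; simp
  have hu := bandSplit_unique (h.isBandLimited_convect_add_gradient_sub_force hS ht) hb
    (h.2.2 t ht) he hdc hec h2
  exact ⟨hu.2.symm, hu.1.symm⟩

end Rung

/-! ## §4 Rung profiles (`S = (−∞, 0)`) -/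

section Profile

variable {L : ℕ} {C₀ c : ℝ} {R : EuclideanSpace ℝ (Fin 3) ≃ₗᵢ[ℝ] EuclideanSpace ℝ (Fin 3)}
  {v : ℝ → EuclideanSpace ℝ (Fin 3) → EuclideanSpace ℝ (Fin 3)}
  {p : ℝ → EuclideanSpace ℝ (Fin 3) → ℝ}
  {d : ℝ → EuclideanSpace ℝ (Fin 3) → EuclideanSpace ℝ (Fin 3)} {t : ℝ}

/-- On a rung profile the time derivative `∂ₜu(t)` (within `(−∞, 0)`, an open set, so the
two-sided derivative) is band-limited of degree `≤ L` at every `t < 0`. [folklore] -/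
theorem IsRungProfile.isBandLimited_timeDerivWithin (h : IsRungProfile L C₀ c R v p d) (ht : t < 0) :
    IsBandLimited L (timeDerivWithin (Iio 0) v t) :=
  h.1.isBandLimited_timeDerivWithin (uniqueDiffOn_Iio 0) ht

/-- On a rung profile, `(u·∇)u + ∇p − d` is band-limited of degree `≤ L` at every `t < 0`.
[folklore] -/
theorem IsRungProfile.isBandLimited_convect_add_gradient_sub_force
    (h : IsRungProfile L C₀ c R v p d) (ht : t < 0) :
    IsBandLimited L fun x => convect (v t) (v t) x + gradient (p t) x - d t x :=
  h.1.isBandLimited_convect_add_gradient_sub_force (uniqueDiffOn_Iio 0) ht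

/-- On a rung profile the defect is determined by the velocity and the pressure: the band
splitting `(u·∇)u + ∇p = b + e` (`b` band-limited, `e` continuous co-band-limited) at `t < 0`
forces `e = d(t)`. [folklore] -/
theorem IsRungProfile.bandSplit_nonlinearity_unique (h : IsRungProfile L C₀ c R v p d) (ht : t < 0)
    {b e : EuclideanSpace ℝ (Fin 3) → EuclideanSpace ℝ (Fin 3)}
    (hb : IsBandLimited L b) (he : IsCobandLimited L e) (hec : Continuous e)
    (hsplit : (fun x => convect (v t) (v t) x + gradient (p t) x) = b + e) : e = d t :=
  (h.1.bandSplit_nonlinearity_unique (uniqueDiffOn_Iio 0) ht hb he hec hsplit).1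

end Profile

end AngularLadder

end Summit.NavierStokesRegularity.FluidComputer

end
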